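import Summits.HodgeConjecture.HodgeConjecture.Theorems.F0LD2SameLabelLineClass
import Literature.NumberTheory.Automorphic.UnitaryGroupAutomorphicFinComponentUnique
import Literature.NumberTheory.Automorphic.Liu2021.Def411WeilCarriersIrreducibleOrZeroAtLine
import HarnessLib

/-!
# LD2 organ U₂″ `SameLabelClasses₂` (LD2-plan (g0) skeleton v5 :260 ∕ v6) CLOSED MODULO THREE LETTERS: the GENERIC finite-component uniqueness letter «AFU» ★
# `UnitaryGroup.AutomorphicFinComponentUnique` ([BorelJacquet1979 §4.6], [Flath1979 Thm. 3–4]; reshape α′) read at the CM curve frames, and the two booked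
# Lem. D.1 letters of ★ p832219 (as R2′)

Cell `hodgecm-mathlib`, half A line LD2 (socket `stub_S1b_facts`, books row #74), seat LD2-p01 (g0), 2026-09-02.  THEOREMS ONLY (no `def`, no named fact, no
instance, no `sorry`); `--supports stmt-HodgeConjecture-24832`.
* §1 (the CURVE COROLLARY's inputs, in-house): the transported θ-carrier `ω(λ, ε_a, χ)_f ∘ (finAdelicCongr g)⁻¹` of the G2 frame is SMOOTH (`isSmooth_thetaCarrier₂`:
  ★ `rhoAtLine_smooth` + ★ `continuous_pairSplitting_chiSplittingLine` + continuity of the frame transport, as ★ `A3Liu418GSOmegaStarSmooth` does for the d6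
  carrier) and, when NON-ZERO, IRREDUCIBLE (`isIrreducible_thetaCarrier₂`: ★ `isIrreducibleOrZero_rhoVAtLine_chiSplittingLine_comp_of_surjective`, rank 2, + ★
  `isIrreducible_of_nontrivial`).
* §2 `sameLabelClasses₂_of_letters (hU) (h4) (h1) : ‹SameLabelClasses₂›` — the organ text token for token (v5 :261–:323): «AFU» at the frame `(L⁺, L, c̄, 2, H, μ)`
  (the binder `hU` = «AFU» universally closed over the CM curve frames `ᵗ(c̄ g)(t • H) g = diag dV`, `dV` real non-zero — genuine unitary groups, inside the
  letter's print-true SCOPE) applied to the irreducible smooth `σ` and the irreducible smooth NON-ZERO carrier `ω(λ, ε_{a′}, χ′)_f ∘ congr⁻¹`, both occurring in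
  `P`, gives the second θ-label `j′ : σ ↪ ω(λ, ε_{a′}, χ′)_f ∘ congr⁻¹` (a `Representation.Equiv`, read as an injective intertwiner, §0); then ★ E₂
  `F0LD2SameLabelLineClass.lineClassRigidity₂_of_letters h4 h1` gives `locF a v = locF a′ v`.  The skeleton closes
  `stub_sameLabelClasses₂ := sameLabelClasses₂_of_letters stub_AFU₂ stub_letter_lemD14_nonsplit stub_letter_lemD11` by `δ` (`stub_AFU₂ : ‹the type of hU›`).
HONEST LABEL: HC_CM is proved only modulo the 7 printed citations (2 remaining: hLiu418 = stmt-HodgeConjecture-24832, h413 = stmt-HodgeConjecture-24833) until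
rung 0 closes; this file discharges none of them and «AFU» is a booked letter (one fan-B row, generic in the rank).

## References
* [Liu2021] Y. Liu, Camb. J. Math. 9 (2021): Def. 4.11; proof of Prop. D.4 (1) (p. 131 L21–23); App. D Lem. D.1 (1), (4) (p. 125–126).
* [BorelJacquet1979] A. Borel, H. Jacquet, PSPM 33.1 (1979), §4.6.  [FlathCorvallis1979] D. Flath, ibid., Thm. 3–4.
* [GelbartRogawski1991] S. Gelbart, J. Rogawski, Invent. Math. 105 (1991), §3.1 Prop. 3.1.1 (locally constant splittings ⇒ smooth coinvariants).
-/


set_option autoImplicit false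
set_option linter.dupNamespace false

noncomputable section

open scoped Matrix ComplexOrder
open NumberField NumberField.InfinitePlace IsDedekindDomain MeasureTheory
open Literature.NumberTheory.Automorphic Literature.NumberTheory.Automorphic.UnitaryGroup
open Literature.NumberTheory.Automorphic.UnitaryCurveForms
open Literature.NumberTheory.Automorphic.Liu2021 Literature.NumberTheory.Automorphic.Liu2021.Def411WeilCarriers
open Literature.NumberTheory.Automorphic.Liu2021.Def411WeilCarriersDoubling
open Literature.NumberTheory.Automorphic.Liu2021.LemD1RankTwoCMLetters
open Literature.NumberTheory.GaloisRepresentations Literature.NumberTheory.Automorphic.IdeleClassGroup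
open Literature.NumberTheory.GelbartRogawski1991 Literature.NumberTheory.GelbartRogawski1991.UnitaryDualPair
open Literature.RepresentationTheory.Liu2021 Literature.RepresentationTheory.HarrisKudlaSweet1996
open Summit.HodgeConjecture.HodgeConjecture.Cruxes.HLiu418.F0LD2SameLabelLineClass

namespace Summit.HodgeConjecture.HodgeConjecture.Cruxes.HLiu418.F0LD2SameLabelClassesOfLetters

/-! ## §0 A `Representation.Equiv` as an injective intertwiner (generic) -/

section Generic

variable {G V V' : Type} [Group G] [AddCommGroup V] [Module ℂ V] [AddCommGroup V'] [Module ℂ V']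
  {ρ : Representation ℂ G V} {τ : Representation ℂ G V'}

/-- The intertwiner underlying a `Representation.Equiv` is injective. [folklore] -/
theorem injective_toIntertwiningMap (e : ρ.Equiv τ) : Function.Injective e.toIntertwiningMap :=
  fun x y hxy => e.toLinearEquiv.injective (by simpa only [Representation.Equiv.toLinearEquiv_apply] using hxy)

end Generic

/-! ## §1 The transported θ-carrier of the G2 frame is smooth, and irreducible when non-zero -/

section Carrier

variable (L : Type) [Field L] [NumberField L] [IsCMField L] {H : Matrix (Fin 2) (Fin 2) L}
  (dV : Fin 2 → L) (hdV : ∀ i, IsCMField.complexConj L (dV i) = dV i) (hdV0 : ∀ i, dV i ≠ 0)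
  {t : L} (ht : t ≠ 0) (g : GL (Fin 2) L)
  (hg : formCongr ((IsCMField.complexConj L : L ≃ₐ[↥(maximalRealSubfield L)] L) : L →+* L) g (t • H) = Matrix.diagonal dV)
  {n' : ℕ} (e₁ : Fin 2 × Fin 1 ≃ Fin n')
  (lam : Literature.NumberTheory.Automorphic.IdeleClassGroup L →ₜ* Circle) (hlam : IsConjugateSymplectic L lam)
  (a : (↥(maximalRealSubfield L))ˣ) (χ : Chi (↥(maximalRealSubfield L)) L (IsCMField.complexConj L))

/-- **The transported θ-carrier `ω(λ, ε_a, χ)_f ∘ (finAdelicCongr g)⁻¹` is SMOOTH** (every vector has open stabiliser, ★ `Representation.IsSmooth`): ★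
`rhoAtLine_smooth` ([GelbartRogawski1991, Prop. 3.1.1]: locally constant splittings ⇒ smooth Weil coinvariants) fed with the continuity of the `λ`-splitting ★
`continuous_pairSplitting_chiSplittingLine` and of the frame transport (a `ContinuousMulEquiv`). [cite: Liu2021, Def. 4.11 (FJcycle.tex l. 2092–2096)]
[cite: GelbartRogawski1991, §3.1 Prop. 3.1.1 p. 455 L1–3] -/
theorem isSmooth_thetaCarrier₂ :
    Representation.IsSmooth ((rhoVAtLine (↥(maximalRealSubfield L)) L (IsCMField.complexConj L) 2 e₁ (Matrix.diagonal dV)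
        (complexConj_imagUnit L) (imagUnit_ne_zero L) (imagUnit_mul_self L) (realDiagonal_isSymm L dV hdV)
        (isUnit_det_realDiagonal L dV hdV hdV0) (realDiagonal_map L dV hdV).symm
        (fun a => isCompatible_chiSplittingLine L e₁ dV hdV hdV0 (toHeckeCharacter L lam)
          (isUnitary_toHeckeCharacter L lam) ((isOscillatorChar_toHeckeCharacter_iff lam).mpr hlam)
          (TW (↥(maximalRealSubfield L)) a) (isSymm_TW (↥(maximalRealSubfield L)) a)
          (isUnit_det_TW (↥(maximalRealSubfield L)) a) (JW (↥(maximalRealSubfield L)) L a)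
          (JW_eq (↥(maximalRealSubfield L)) L a)) a χ).comp
      (finAdelicCongr (↥(maximalRealSubfield L)) L (IsCMField.complexConj L) g ht hg).symm.toMonoidHom) := by
  intro v
  obtain ⟨S, hS, hfix⟩ := rhoAtLine_smooth (↥(maximalRealSubfield L)) L (IsCMField.complexConj L) 2 e₁ (Matrix.diagonal dV)
        (complexConj_imagUnit L) (imagUnit_ne_zero L) (imagUnit_mul_self L) (realDiagonal_isSymm L dV hdV)
        (isUnit_det_realDiagonal L dV hdV hdV0) (realDiagonal_map L dV hdV).symm
        (fun a => isCompatible_chiSplittingLine L e₁ dV hdV hdV0 (toHeckeCharacter L lam)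
          (isUnitary_toHeckeCharacter L lam) ((isOscillatorChar_toHeckeCharacter_iff lam).mpr hlam)
          (TW (↥(maximalRealSubfield L)) a) (isSymm_TW (↥(maximalRealSubfield L)) a)
          (isUnit_det_TW (↥(maximalRealSubfield L)) a) (JW (↥(maximalRealSubfield L)) L a)
          (JW_eq (↥(maximalRealSubfield L)) L a))
    (finAdelicCongr (↥(maximalRealSubfield L)) L (IsCMField.complexConj L) g ht hg).symm.toMonoidHom
    (finAdelicCongr (↥(maximalRealSubfield L)) L (IsCMField.complexConj L) g ht hg).symm.continuous
    (fun b => continuous_pairSplitting_chiSplittingLine L e₁ dV hdV hdV0 (toHeckeCharacter L lam)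
      (isUnitary_toHeckeCharacter L lam) ((isOscillatorChar_toHeckeCharacter_iff lam).mpr hlam)
      (TW (↥(maximalRealSubfield L)) b) (isUnit_det_TW (↥(maximalRealSubfield L)) b) (JW (↥(maximalRealSubfield L)) L b)
      (JW_eq (↥(maximalRealSubfield L)) L b)) a χ v
  exact Representation.isSmoothVector_of_le _ hS fun k hk => hfix k hk

/-- **The transported θ-carrier, when NON-ZERO, is IRREDUCIBLE** (rank 2: ★ `isIrreducibleOrZero_rhoVAtLine_chiSplittingLine_comp_of_surjective` along the
surjective frame transport, + ★ `isIrreducible_of_nontrivial`). [cite: Liu2021, Def. 4.11; App. D Lem. D.1 (1) (p. 125)] -/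
theorem isIrreducible_thetaCarrier₂
    [Nontrivial (omegaAtLine (↥(maximalRealSubfield L)) L (IsCMField.complexConj L) 2 e₁ (Matrix.diagonal dV)
        (complexConj_imagUnit L) (imagUnit_ne_zero L) (imagUnit_mul_self L) (realDiagonal_isSymm L dV hdV)
        (isUnit_det_realDiagonal L dV hdV hdV0) (realDiagonal_map L dV hdV).symm
        (fun a => isCompatible_chiSplittingLine L e₁ dV hdV hdV0 (toHeckeCharacter L lam)
          (isUnitary_toHeckeCharacter L lam) ((isOscillatorChar_toHeckeCharacter_iff lam).mpr hlam)
          (TW (↥(maximalRealSubfield L)) a) (isSymm_TW (↥(maximalRealSubfield L)) a)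
          (isUnit_det_TW (↥(maximalRealSubfield L)) a) (JW (↥(maximalRealSubfield L)) L a)
          (JW_eq (↥(maximalRealSubfield L)) L a)) a χ)] :
    Representation.IsIrreducible ((rhoVAtLine (↥(maximalRealSubfield L)) L (IsCMField.complexConj L) 2 e₁ (Matrix.diagonal dV)
        (complexConj_imagUnit L) (imagUnit_ne_zero L) (imagUnit_mul_self L) (realDiagonal_isSymm L dV hdV)
        (isUnit_det_realDiagonal L dV hdV hdV0) (realDiagonal_map L dV hdV).symm
        (fun a => isCompatible_chiSplittingLine L e₁ dV hdV hdV0 (toHeckeCharacter L lam)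
          (isUnitary_toHeckeCharacter L lam) ((isOscillatorChar_toHeckeCharacter_iff lam).mpr hlam)
          (TW (↥(maximalRealSubfield L)) a) (isSymm_TW (↥(maximalRealSubfield L)) a)
          (isUnit_det_TW (↥(maximalRealSubfield L)) a) (JW (↥(maximalRealSubfield L)) L a)
          (JW_eq (↥(maximalRealSubfield L)) L a)) a χ).comp
      (finAdelicCongr (↥(maximalRealSubfield L)) L (IsCMField.complexConj L) g ht hg).symm.toMonoidHom) := by
  -- `2 ≤ n'` (★ `F0P5CurveThetaCompanionRelabelOfLocalFactors.two_le_of_finTwo_equiv`, inlined)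
  have hn' : 2 ≤ n' := by
    have h := Fintype.card_congr e₁
    simp only [Fintype.card_prod, Fintype.card_fin, mul_one] at h
    omega
  have hφ : Function.Surjective (finAdelicCongr (↥(maximalRealSubfield L)) L (IsCMField.complexConj L) g ht hg).symm.toMonoidHom :=
    fun y => ⟨(finAdelicCongr (↥(maximalRealSubfield L)) L (IsCMField.complexConj L) g ht hg) y,
      (finAdelicCongr (↥(maximalRealSubfield L)) L (IsCMField.complexConj L) g ht hg).symm_apply_apply y⟩
  exact isIrreducible_of_nontrivial (isIrreducibleOrZero_rhoVAtLine_chiSplittingLine_comp_of_surjective L e₁ hn' dV hdV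
    hdV0 (toHeckeCharacter L lam) (isUnitary_toHeckeCharacter L lam) ((isOscillatorChar_toHeckeCharacter_iff lam).mpr hlam) a χ
    (finAdelicCongr (↥(maximalRealSubfield L)) L (IsCMField.complexConj L) g ht hg).symm.toMonoidHom hφ)

end Carrier

/-! ## §2 The organ U₂″ `SameLabelClasses₂` from «AFU» and the two Lem. D.1 letters -/

/-- **U₂″ `SameLabelClasses₂` modulo «AFU» (at the CM curve frames), h4, h1** (organ text of LD2-plan skeleton v5 :260 verbatim): the irreducible smooth `σ`
and the irreducible smooth non-zero θ-carrier `ω(λ, ε_{a′}, χ′)_f ∘ congr⁻¹` both occur in the discrete `P`, so «AFU» embeds `σ` into the latter (`j′`), and ★ E₂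
`lineClassRigidity₂_of_letters h4 h1` equates the line classes place by place. [cite: BorelJacquet1979, §4.6] [cite: FlathCorvallis1979, Thm. 3]
[cite: Liu2021, App. D, proof of Prop. D.4 (1) (p. 131 L21–23); Lem. D.1 (1), (4) (p. 125–126)] -/
theorem sameLabelClasses₂_of_letters
    (hU : ∀ (L : Type) [Field L] [NumberField L] [IsCMField L] (H : Matrix (Fin 2) (Fin 2) L) (dV : Fin 2 → L),
      (∀ i, IsCMField.complexConj L (dV i) = dV i) → (∀ i, dV i ≠ 0) → ∀ (t : L), t ≠ 0 → ∀ g : GL (Fin 2) L,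
      formCongr ((IsCMField.complexConj L : L ≃ₐ[↥(maximalRealSubfield L)] L) : L →+* L) g (t • H) = Matrix.diagonal dV →
      ∀ (μ : Measure (adelicGroupData (↥(maximalRealSubfield L)) L (IsCMField.complexConj L) 2 H).automorphicQuotient)
        [(adelicGroupData (↥(maximalRealSubfield L)) L (IsCMField.complexConj L) 2 H).IsAutomorphicMeasure μ],
      AutomorphicFinComponentUnique (↥(maximalRealSubfield L)) L (IsCMField.complexConj L) 2 H μ)
    (h4 : LemD1_4AsPrintedNonsplitCM₂) (h1 : LemD1_1AsPrintedCM₂) :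
  ∀ (L : Type) [Field L] [NumberField L] [IsCMField L] (ι : L →+* ℂ) (H : Matrix (Fin 2) (Fin 2) L)
    (dV : Fin 2 → L) (hdV : ∀ i, IsCMField.complexConj L (dV i) = dV i) (hdV0 : ∀ i, dV i ≠ 0)
    (t : L) (ht : t ≠ 0) (g : GL (Fin 2) L)
    (hg : formCongr ((IsCMField.complexConj L : L ≃ₐ[↥(maximalRealSubfield L)] L) : L →+* L) g (t • H) = Matrix.diagonal dV),
    (∃ T : GL (Fin 2) ℂ, formCongr (starRingEnd ℂ) T ((Matrix.diagonal dV).map ι) = Matrix.diagonal ![(1 : ℂ), -1]) →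
    (∀ τ' : L →+* ℂ, InfinitePlace.mk τ' ≠ InfinitePlace.mk ι → ((Matrix.diagonal dV).map τ').PosDef) →
    4 ≤ Module.finrank ℚ L →
    ∀ (𝔣 : ConeFrame L H (cmPlace L ι))
      (μ : Measure (adelicGroupData (↥(maximalRealSubfield L)) L (IsCMField.complexConj L) 2 H).automorphicQuotient)
      [(adelicGroupData (↥(maximalRealSubfield L)) L (IsCMField.complexConj L) 2 H).IsAutomorphicMeasure μ]
      {n' : ℕ} (e₁ : Fin 2 × Fin 1 ≃ Fin n')
      (lam : Literature.NumberTheory.Automorphic.IdeleClassGroup L →ₜ* Circle) (hlam : IsConjugateSymplectic L lam), HasWeight L lam 1 →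
    ∀ (a : (↥(maximalRealSubfield L))ˣ) (χ : Chi (↥(maximalRealSubfield L)) L (IsCMField.complexConj L))
      (W : Type) [AddCommGroup W] [Module ℂ W]
      (σ : Representation ℂ (finAdelic (↥(maximalRealSubfield L)) L (IsCMField.complexConj L) 2 H) W),
      σ.IsIrreducible → σ.IsSmooth →
    ∀ j : σ.IntertwiningMap
        ((rhoVAtLine (↥(maximalRealSubfield L)) L (IsCMField.complexConj L) 2 e₁ (Matrix.diagonal dV)
            (complexConj_imagUnit L) (imagUnit_ne_zero L) (imagUnit_mul_self L) (realDiagonal_isSymm L dV hdV)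
            (isUnit_det_realDiagonal L dV hdV hdV0) (realDiagonal_map L dV hdV).symm
            (fun a => isCompatible_chiSplittingLine L e₁ dV hdV hdV0 (toHeckeCharacter L lam)
              (isUnitary_toHeckeCharacter L lam) ((isOscillatorChar_toHeckeCharacter_iff lam).mpr hlam)
              (TW (↥(maximalRealSubfield L)) a) (isSymm_TW (↥(maximalRealSubfield L)) a)
              (isUnit_det_TW (↥(maximalRealSubfield L)) a) (JW (↥(maximalRealSubfield L)) L a)
              (JW_eq (↥(maximalRealSubfield L)) L a)) a χ).comp
          (finAdelicCongr (↥(maximalRealSubfield L)) L (IsCMField.complexConj L) g ht hg).symm.toMonoidHom),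
      Function.Injective j →
    ∀ P : DiscreteAutomorphicRep (adelicGroupData (↥(maximalRealSubfield L)) L (IsCMField.complexConj L) 2 H) μ,
      P.IsHolCotangentAt₂ (IsCMField.complexConj_ne_one L) (UnitaryGroup.complexConj_smul_infinitePlace L) (cmPlace L ι) 𝔣 →
      P.HasFinComponent σ →
    ∀ (a' : (↥(maximalRealSubfield L))ˣ) (χ' : Chi (↥(maximalRealSubfield L)) L (IsCMField.complexConj L)),
      Nontrivial
        (omegaAtLine (↥(maximalRealSubfield L)) L (IsCMField.complexConj L) 2 e₁ (Matrix.diagonal dV)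
            (complexConj_imagUnit L) (imagUnit_ne_zero L) (imagUnit_mul_self L) (realDiagonal_isSymm L dV hdV)
            (isUnit_det_realDiagonal L dV hdV hdV0) (realDiagonal_map L dV hdV).symm
            (fun a => isCompatible_chiSplittingLine L e₁ dV hdV hdV0 (toHeckeCharacter L lam)
              (isUnitary_toHeckeCharacter L lam) ((isOscillatorChar_toHeckeCharacter_iff lam).mpr hlam)
              (TW (↥(maximalRealSubfield L)) a) (isSymm_TW (↥(maximalRealSubfield L)) a)
              (isUnit_det_TW (↥(maximalRealSubfield L)) a) (JW (↥(maximalRealSubfield L)) L a)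
              (JW_eq (↥(maximalRealSubfield L)) L a)) a' χ') →
      P.HasFinComponent
          ((rhoVAtLine (↥(maximalRealSubfield L)) L (IsCMField.complexConj L) 2 e₁ (Matrix.diagonal dV)
              (complexConj_imagUnit L) (imagUnit_ne_zero L) (imagUnit_mul_self L) (realDiagonal_isSymm L dV hdV)
              (isUnit_det_realDiagonal L dV hdV hdV0) (realDiagonal_map L dV hdV).symm
              (fun a => isCompatible_chiSplittingLine L e₁ dV hdV hdV0 (toHeckeCharacter L lam)
                (isUnitary_toHeckeCharacter L lam) ((isOscillatorChar_toHeckeCharacter_iff lam).mpr hlam)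
                (TW (↥(maximalRealSubfield L)) a) (isSymm_TW (↥(maximalRealSubfield L)) a)
                (isUnit_det_TW (↥(maximalRealSubfield L)) a) (JW (↥(maximalRealSubfield L)) L a)
                (JW_eq (↥(maximalRealSubfield L)) L a)) a' χ').comp
            (finAdelicCongr (↥(maximalRealSubfield L)) L (IsCMField.complexConj L) g ht hg).symm.toMonoidHom) →
      ∀ v : HeightOneSpectrum (𝓞 ↥(maximalRealSubfield L)),
        locF (↥(maximalRealSubfield L)) (imagUnitSq L) a' v = locF (↥(maximalRealSubfield L)) (imagUnitSq L) a v := by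
  intro L _ _ _ ι H dV hdV hdV0 t ht g hg hsig₁ hsig₂ hL 𝔣 μ _ n' e₁ lam hlam hw a χ W _ _ σ hirr hsm j hj P hP hfin a' χ' hnt hfin' v
  -- «AFU» at the frame `(L⁺, L, c̄, 2, H, μ)`: `σ ≅ ω(λ, ε_{a′}, χ′)_f ∘ congr⁻¹` (`Nonempty.elim`, not `obtain`: `rcases`'s `whnf` is too expensive here)
  refine (hU L H dV hdV hdV0 t ht g hg μ P W σ _ _ hirr hsm
    (isIrreducible_thetaCarrier₂ L dV hdV hdV0 ht g hg e₁ lam hlam a' χ') (isSmooth_thetaCarrier₂ L dV hdV hdV0 ht g hg e₁ lam hlam a' χ')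
    hfin hfin').elim fun e => ?_
  exact (lineClassRigidity₂_of_letters h4 h1 L ι H dV hdV hdV0 t ht g hg hsig₁ hsig₂ hL 𝔣 μ e₁ lam hlam hw a a' χ χ' W σ hirr hsm j hj
    e.toIntertwiningMap (injective_toIntertwiningMap e) v).symm

end Summit.HodgeConjecture.HodgeConjecture.Cruxes.HLiu418.F0LD2SameLabelClassesOfLetters

end
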